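import Summits.QuantumAdvantage.QuantumAdvantage.Theorems.CharDialJBlockTop
import Summits.QuantumAdvantage.QuantumAdvantage.Theorems.CharDialMultiBlockFrob
import Summits.QuantumAdvantage.QuantumAdvantage.Theorems.CharDialJLinDegree
import HarnessLib

/-!
# JBlockFrob — the Frobenius structure law on the JUNTA-AUGMENTED block class (kernel)

(decomp-qadv-lens-6 g8.)  `SubChar.jBlock_frob`: if a Boolean `f` of `𝔽_p`-degree `≤ p − 1` depends only on
`(u|_J, wt_{A_1}(u), …, wt_{A_m}(u))` for a set `J` and disjoint blocks `A_j` (each `≥ p − 1`, disjoint from `J`), then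
`f(u) = h(u|_J, Σ_j a_j wt_{A_j}(u))` — ONE block-linear form, uniformly over the `J`-pattern.  This is exactly the
conclusion shape `h(u_J, Σ aᵢuᵢ)` of the CharDial node's `FrobStructureLaw` (law 2½), proved on the whole class of
profile functions; `J = ∅` is `mBlock_frob`.
Proof: induction on `J`.  Peel `j0`: both restrictions `u_{j0} := σ` are `h_σ(u|_J, Σ a_{σ,j} wt_j)` by induction.
`deg f ≤ p − 1` forces, for every `J`-pattern `τ`, `[h_1(τ, ℓ_1)] − [h_0(τ, ℓ_0)]` to have degree `≤ p − 2`
(`sub_mem_lowDeg_of_split`), hence equal Möbius coefficients at all `(p−1)`-sets inside the blocks; reading those at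
`p − 1` coordinates of one block (`moeb_blockTop`: `±[a_j ≠ 0]·N(h)`) and at `p − 2` of block `j` plus one of block
`k` (`moeb_blockNext`: `∓(a_k/a_j)·N(h)`) gives `a_1 = λ a_0` (`direction_extract`) unless both restrictions ignore
the blocks (`const_of_resCount_eq_zero`), and in every case the two representations merge.
The file opens with the VALUES of the two top coefficients (`resCount`, `sum_range_ind`, `sum_range_moment`,
`const_of_resCount_eq_zero`, `direction_extract`).
-/

namespace Summit.QuantumAdvantage.AdviceFreeQNC0

namespace SubChar

open Finset
open Literature.Computability.MetaComplexity Literature.Computability.MetaComplexity.Smolensky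
open SubLog JLin

variable {n m : ℕ}

/-- CharDial sub-characteristic helper `proj_proj_insert` (lens-6 g8 LAND package; see the module docstring). -/
theorem proj_proj_insert (J : Finset (Fin n)) (j0 : Fin n) (u : Fin n → Bool) :
    proj J (proj (insert j0 J) u) = proj J u := by
  funext i
  by_cases hi : i ∈ J
  · simp [proj, hi, mem_insert_of_mem hi]
  · simp [proj, hi]

/-- CharDial sub-characteristic helper `proj_insert_self` (lens-6 g8 LAND package; see the module docstring). -/
theorem proj_insert_self (J : Finset (Fin n)) (j0 : Fin n) (u : Fin n → Bool) :
    proj (insert j0 J) u j0 = u j0 := by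
  simp [proj]

variable {p : ℕ} [hp : Fact p.Prime]

/-! ### Values of the top coefficients -/

/-- The number of residues where `h` holds, in `𝔽_p`. -/
def resCount (hh : ZMod p → Bool) : ZMod p := ∑ c : ZMod p, if hh c then (1 : ZMod p) else 0

/-- CharDial sub-characteristic helper `sum_range_eq_sum_zmod` (lens-6 g8 LAND package; see the module docstring). -/
theorem sum_range_eq_sum_zmod {R : Type*} [AddCommMonoid R] (G : ZMod p → R) :
    ∑ s ∈ range p, G (s : ZMod p) = ∑ z : ZMod p, G z := by
  rw [Finset.sum_range (fun s => G (s : ZMod p))]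
  refine Fintype.sum_bijective (fun i : Fin p => ((i : ℕ) : ZMod p)) ?_ _ _ (fun _ => rfl)
  rw [Fintype.bijective_iff_injective_and_card, ZMod.card, Fintype.card_fin]
  refine ⟨fun i i' h => Fin.ext ?_, rfl⟩
  have := congrArg ZMod.val h
  simp only [ZMod.val_natCast, Nat.mod_eq_of_lt i.isLt, Nat.mod_eq_of_lt i'.isLt] at this
  exact this

/-- CharDial sub-characteristic helper `sum_ind_mul` (lens-6 g8 LAND package; see the module docstring). -/
theorem sum_ind_mul (hh : ZMod p → Bool) {c : ZMod p} (hc : c ≠ 0) :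
    ∑ z : ZMod p, (if hh (c * z) then (1 : ZMod p) else 0) = resCount hh := by
  unfold resCount
  exact Fintype.sum_bijective (fun z => c * z) (Finite.injective_iff_bijective.1 (mul_right_injective₀ hc)) _ _ (fun _ => rfl)

/-- CharDial sub-characteristic helper `sum_range_ind` (lens-6 g8 LAND package; see the module docstring). -/
theorem sum_range_ind (hh : ZMod p → Bool) (c : ZMod p) :
    ∑ s ∈ range p, (if hh (c * (s : ZMod p)) then (1 : ZMod p) else 0) = if c = 0 then 0 else resCount hh := by
  by_cases hc : c = 0
  · rw [if_pos hc]
    simp only [hc, zero_mul, Finset.sum_const, card_range, nsmul_eq_mul, ZMod.natCast_self, zero_mul]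
  · rw [if_neg hc, sum_range_eq_sum_zmod (fun z => if hh (c * z) then (1 : ZMod p) else 0), sum_ind_mul hh hc]

/-- CharDial sub-characteristic helper `sum_moment` (lens-6 g8 LAND package; see the module docstring). -/
theorem sum_moment (hh : ZMod p → Bool) {c : ZMod p} (hc : c ≠ 0) (d : ZMod p) :
    ∑ z : ZMod p, (z + 1) * ((if hh (c * z + d) then (1 : ZMod p) else 0) - (if hh (c * z) then (1 : ZMod p) else 0))
      = -(d / c) * resCount hh := by
  simp_rw [mul_sub]
  rw [Finset.sum_sub_distrib]
  have h1 : ∑ z : ZMod p, (z + 1) * (if hh (c * z + d) then (1 : ZMod p) else 0) =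
      ∑ y : ZMod p, (y - d / c + 1) * (if hh (c * y) then (1 : ZMod p) else 0) := by
    refine Fintype.sum_bijective (fun z => z + d / c)
      (Finite.injective_iff_bijective.1 (add_left_injective (d / c))) _ _ fun z => ?_
    have : c * (z + d / c) = c * z + d := by field_simp
    rw [this]
    ring
  rw [h1, ← Finset.sum_sub_distrib, ← sum_ind_mul hh hc, Finset.mul_sum]
  exact Finset.sum_congr rfl fun y _ => by ring

/-- CharDial sub-characteristic helper `sum_range_moment` (lens-6 g8 LAND package; see the module docstring). -/
theorem sum_range_moment (hh : ZMod p → Bool) {c : ZMod p} (hc : c ≠ 0) (d : ZMod p) :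
    ∑ s ∈ range (p - 1), ((s : ZMod p) + 1) *
        ((if hh (c * (s : ZMod p) + d) then (1 : ZMod p) else 0) - (if hh (c * (s : ZMod p)) then (1 : ZMod p) else 0))
      = -(d / c) * resCount hh := by
  have hp1 : 1 < p := hp.out.one_lt
  have hlast : ((p - 1 : ℕ) : ZMod p) + 1 = 0 := by
    have : ((p - 1 : ℕ) : ZMod p) + 1 = ((p - 1 + 1 : ℕ) : ZMod p) := by push_cast; ring
    rw [this, Nat.sub_add_cancel hp1.le, ZMod.natCast_self]
  have e : ∑ s ∈ range p, ((s : ZMod p) + 1) *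
      ((if hh (c * (s : ZMod p) + d) then (1 : ZMod p) else 0) - (if hh (c * (s : ZMod p)) then (1 : ZMod p) else 0))
      = ∑ s ∈ range (p - 1), ((s : ZMod p) + 1) *
      ((if hh (c * (s : ZMod p) + d) then (1 : ZMod p) else 0) - (if hh (c * (s : ZMod p)) then (1 : ZMod p) else 0)) := by
    conv_lhs => rw [show Finset.range p = Finset.range (p - 1 + 1) by rw [Nat.sub_add_cancel hp1.le]]
    rw [Finset.sum_range_succ, hlast, zero_mul, add_zero]
  rw [← e, sum_range_eq_sum_zmod (fun z => (z + 1) *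
    ((if hh (c * z + d) then (1 : ZMod p) else 0) - (if hh (c * z) then (1 : ZMod p) else 0))), sum_moment hh hc d]

/-- `resCount h = 0` forces `h` to be constant (`0 ≤ #{h} ≤ p`). -/
theorem const_of_resCount_eq_zero {hh : ZMod p → Bool} (h0 : resCount hh = 0) : ∀ z, hh z = hh 0 := by
  classical
  have hc : resCount hh = ((Finset.univ.filter fun c : ZMod p => hh c = true).card : ZMod p) := by
    unfold resCount
    rw [Finset.natCast_card_filter]
  rw [hc, ZMod.natCast_eq_zero_iff] at h0
  obtain ⟨q, hq⟩ := h0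
  have hle : (Finset.univ.filter fun c : ZMod p => hh c = true).card ≤ p :=
    (card_filter_le _ _).trans (by rw [Finset.card_univ, ZMod.card])
  have hp0 : 0 < p := hp.out.pos
  have hq1 : q ≤ 1 := by
    by_contra h
    have : p * 2 ≤ p * q := Nat.mul_le_mul_left p (by omega)
    omega
  intro z
  interval_cases q
  · rw [mul_zero, Finset.card_eq_zero, filter_eq_empty_iff] at hq
    have hz : hh z = false := by simpa using hq (mem_univ z)
    have h0' : hh 0 = false := by simpa using hq (mem_univ 0)
    rw [hz, h0']
  · rw [mul_one] at hq
    have huniv := Finset.eq_univ_of_card _ (by rw [hq, ZMod.card])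
    have hmem : ∀ y : ZMod p, y ∈ Finset.univ.filter (fun c : ZMod p => hh c = true) := by
      intro y; rw [huniv]; exact mem_univ y
    have hz : hh z = true := (mem_filter.1 (hmem z)).2
    have h0' : hh 0 = true := (mem_filter.1 (hmem 0)).2
    rw [hz, h0']

/-! ### Extracting the direction -/

/-- Equal top data force proportional coefficient vectors. -/
theorem direction_extract {a b : Fin m → ZMod p} {N M : ZMod p} (hN : N ≠ 0) {j : Fin m} (hj : a j ≠ 0)
    (hV : ∀ k, (if a k = 0 then (0 : ZMod p) else N) = (if b k = 0 then 0 else M))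
    (hR : ∀ k, k ≠ j → b j ≠ 0 → -(a k / a j) * N = -(b k / b j) * M) :
    ∃ c : ZMod p, c ≠ 0 ∧ ∀ k, b k = c * a k := by
  have hVj := hV j
  rw [if_neg hj] at hVj
  have hbj : b j ≠ 0 := by
    intro h; rw [if_pos h] at hVj; exact hN hVj
  rw [if_neg hbj] at hVj
  -- hVj : N = M
  refine ⟨b j / a j, div_ne_zero hbj hj, fun k => ?_⟩
  by_cases hkj : k = j
  · subst hkj; field_simp
  · have h := hR k hkj hbj
    rw [← hVj, neg_mul, neg_mul, neg_inj] at h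
    have h2 : a k / a j = b k / b j := mul_right_cancel₀ hN h
    rw [div_eq_div_iff hj hbj] at h2
    rw [div_mul_eq_mul_div, eq_div_iff hj]
    linear_combination (-1 : ZMod p) * h2


/-- The block-linear form as a single coefficient vector (constant on blocks, zero off them). -/
theorem blin_eq_form (A : Fin m → Finset (Fin n)) (a : Fin m → ZMod p) (u : Fin n → Bool) :
    blin A a u = ∑ i, if u i then (∑ j, if i ∈ A j then a j else 0) else 0 := by
  classical
  unfold blin
  have h1 : ∀ j, a j * ((bw (A j) u : ℕ) : ZMod p)
      = ∑ i, if u i then (if i ∈ A j then a j else 0) else 0 := by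
    intro j
    rw [natCast_bw, Finset.mul_sum]
    have : (∑ i ∈ A j, a j * (if u i then (1 : ZMod p) else 0))
        = ∑ i, if i ∈ A j then a j * (if u i then (1 : ZMod p) else 0) else 0 := by
      rw [Finset.sum_ite_mem, Finset.univ_inter]
    rw [this]
    refine Finset.sum_congr rfl fun i _ => ?_
    by_cases hi : i ∈ A j <;> by_cases hu : u i <;> simp [hi, hu]
  rw [Finset.sum_congr rfl fun j _ => h1 j, Finset.sum_comm]
  refine Finset.sum_congr rfl fun i _ => ?_
  by_cases hu : u i
  · simp [hu]
  · simp [hu]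

/-- **The Frobenius structure law on the junta-augmented block class** (all `m`, `n`, `p`, `J`). -/
theorem jBlock_frob (p : ℕ) [hp : Fact p.Prime] (A : Fin m → Finset (Fin n))
    (hdis : ∀ j k, j ≠ k → Disjoint (A j) (A k)) (hA : ∀ j, p - 1 ≤ (A j).card) :
    ∀ (J : Finset (Fin n)), (∀ j, Disjoint J (A j)) → ∀ f : (Fin n → Bool) → Bool,
      (∀ u v : Fin n → Bool, (∀ i ∈ J, u i = v i) → (∀ j, bw (A j) u = bw (A j) v) → f u = f v) →
      HasDegF p f (p - 1) →
      ∃ (a : Fin m → ZMod p) (h : (Fin n → Bool) → ZMod p → Bool), ∀ u,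
        f u = h (proj J u) (blin A a u) := by
  classical
  have hp1 : 1 < p := hp.out.one_lt
  intro J
  induction J using Finset.induction_on with
  | empty =>
    intro _ f hsym hf
    obtain ⟨a, h, hh⟩ := mBlock_frob p A hdis hA f (fun u v huv => hsym u v (by simp) huv) hf
    refine ⟨a, fun _ z => h z, fun u => ?_⟩
    rw [hh u]
    show _ = h (blin A a u)
    unfold blin
    rw [show (∑ j, a j * ((bw (A j) u : ℕ) : ZMod p)) = ∑ j, a j * ∑ i ∈ A j, (if u i then (1 : ZMod p) else 0)
      from Finset.sum_congr rfl fun j _ => by rw [natCast_bw]]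
  | insert j0 J hj0 ih =>
    intro hJ f hsym hf
    have hj0A : ∀ j, j0 ∉ A j := fun j h => disjoint_left.1 (hJ j) (mem_insert_self j0 J) h
    have hJ' : ∀ j, Disjoint J (A j) := fun j => (hJ j).mono_left (subset_insert j0 J)
    -- the two restrictions `u_{j0} := σ`, by induction
    have hres : ∀ σ : Bool, ∃ (a : Fin m → ZMod p) (h : (Fin n → Bool) → ZMod p → Bool),
        ∀ u, f (Function.update u j0 σ) = h (proj J u) (blin A a u) := by
      intro σ
      refine ih hJ' (fun u => f (Function.update u j0 σ)) ?_ ?_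
      · intro u v hJuv hbuv
        refine hsym _ _ (fun i hi => ?_) (fun j => ?_)
        · rcases mem_insert.1 hi with rfl | hi'
          · simp
          · have hne : i ≠ j0 := fun h => hj0 (h ▸ hi')
            rw [Function.update_of_ne hne, Function.update_of_ne hne, hJuv i hi']
        · rw [bw_update_of_notMem (hj0A j), bw_update_of_notMem (hj0A j), hbuv j]
      · unfold HasDegF at hf ⊢
        exact comp_subst_mem_lowDeg (fun u => Function.update u j0 σ)
          (fun i => if hi : i = j0 then Or.inl ⟨σ, fun u => by
              show Function.update u j0 σ i = σ
              rw [hi, Function.update_self]⟩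
            else Or.inr ⟨i, fun u => by
              show Function.update u j0 σ i = u i
              rw [Function.update_of_ne hi]⟩) hf
    choose a h hrep using hres
    have hf_eq : ∀ u, f u = h (u j0) (proj J u) (blin A (a (u j0)) u) := by
      intro u
      have := hrep (u j0) u
      rwa [Function.update_eq_self] at this
    -- TOP COMPARISON at a J-pattern τ
    let Φ : (Fin n → Bool) → Bool → CubeFn (ZMod p) n :=
      fun τ σ u => if h σ (proj J τ) (blin A (a σ) u) then 1 else 0
    have hΦind : ∀ τ σ u b, Φ τ σ (Function.update u j0 b) = Φ τ σ u := by
      intro τ σ u b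
      simp only [Φ, blin_congr (a σ) (fun j => bw_update_of_notMem (hj0A j) u b)]
    have hdiff : ∀ τ, Φ τ true - Φ τ false ∈ lowDeg (ZMod p) n (p - 2) := by
      intro τ
      let e : (Fin n → Bool) → (Fin n → Bool) := fun u i => if i ∈ J then τ i else u i
      have he0 : ∀ u, e u j0 = u j0 := fun u => by
        show (if j0 ∈ J then τ j0 else u j0) = u j0
        rw [if_neg hj0]
      have heproj : ∀ u, proj J (e u) = proj J τ := by
        intro u; funext i
        by_cases hi : i ∈ J
        · show (if i ∈ J then (if i ∈ J then τ i else u i) else false) = if i ∈ J then τ i else false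
          rw [if_pos hi, if_pos hi, if_pos hi]
        · show (if i ∈ J then (if i ∈ J then τ i else u i) else false) = if i ∈ J then τ i else false
          rw [if_neg hi, if_neg hi]
      have hebw : ∀ u j, bw (A j) (e u) = bw (A j) u := by
        intro u j
        exact bw_congr fun i hi => by
          show (if i ∈ J then τ i else u i) = u i
          rw [if_neg (disjoint_right.1 (hJ' j) hi)]
      have hg : (fun u => (fun x => if f x then (1 : ZMod p) else 0) (e u)) ∈ lowDeg (ZMod p) n (p - 2 + 1) := by
        rw [show p - 2 + 1 = p - 1 by omega]
        exact comp_subst_mem_lowDeg e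
          (fun i => if hi : i ∈ J then Or.inl ⟨τ i, fun u => by
              show (if i ∈ J then τ i else u i) = τ i
              rw [if_pos hi]⟩
            else Or.inr ⟨i, fun u => by
              show (if i ∈ J then τ i else u i) = u i
              rw [if_neg hi]⟩) hf
      refine sub_mem_lowDeg_of_split hg (hΦind τ false) (hΦind τ true) fun u => ?_
      show (if f (e u) then (1 : ZMod p) else 0) = if u j0 then Φ τ true u else Φ τ false u
      rw [hf_eq (e u), he0, heproj, blin_congr (a (u j0)) (hebw u)]
      cases u j0 <;> simp [Φ]
    have htop : ∀ τ (S : Finset (Fin n)), S.card = p - 1 → moeb (Φ τ true) S = moeb (Φ τ false) S := by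
      intro τ S hS
      have := moeb_eq_zero_of_mem_lowDeg (hdiff τ) (S := S) (by omega)
      rw [moeb_sub] at this
      exact sub_eq_zero.1 this
    -- E1: the resCount data agree
    have hE1 : ∀ τ j, (if a false j = 0 then (0 : ZMod p) else resCount (h false (proj J τ))) =
        (if a true j = 0 then 0 else resCount (h true (proj J τ))) := by
      intro τ j
      obtain ⟨S, hS, hScard⟩ := Finset.exists_subset_card_eq (hA j)
      have h1 := htop τ S hScard
      change moeb (fun u => if h true (proj J τ) (blin A (a true) u) then (1 : ZMod p) else 0) S =
        moeb (fun u => if h false (proj J τ) (blin A (a false) u) then (1 : ZMod p) else 0) S at h1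
      rw [moeb_blockTop hdis hS hScard (h true (proj J τ)) (a true),
        moeb_blockTop hdis hS hScard (h false (proj J τ)) (a false),
        sum_range_ind, sum_range_ind] at h1
      have hu : ((-1 : ZMod p) ^ (p - 1)) ≠ 0 := pow_ne_zero _ (neg_ne_zero.2 one_ne_zero)
      exact (mul_left_cancel₀ hu h1).symm
    -- E2: the moment data agree
    have hE2 : ∀ τ j k, k ≠ j → a false j ≠ 0 → a true j ≠ 0 →
        -(a false k / a false j) * resCount (h false (proj J τ)) =
          -(a true k / a true j) * resCount (h true (proj J τ)) := by
      intro τ j k hkj hfj htj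
      obtain ⟨S, hS, hScard⟩ := Finset.exists_subset_card_eq (show p - 2 ≤ (A j).card by have := hA j; omega)
      obtain ⟨k0, hk0⟩ := Finset.card_pos.1 (show 0 < (A k).card by have := hA k; omega)
      have hk0S : k0 ∉ S := fun hm => disjoint_left.1 (hdis j k (Ne.symm hkj)) (hS hm) hk0
      have hcard' : (insert k0 S).card = p - 1 := by rw [card_insert_of_notMem hk0S, hScard]; omega
      have h1 := htop τ (insert k0 S) hcard'
      change moeb (fun u => if h true (proj J τ) (blin A (a true) u) then (1 : ZMod p) else 0) (insert k0 S) =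
        moeb (fun u => if h false (proj J τ) (blin A (a false) u) then (1 : ZMod p) else 0) (insert k0 S) at h1
      rw [moeb_blockNext hdis (Ne.symm hkj) hS hScard hk0 (h true (proj J τ)) (a true),
        moeb_blockNext hdis (Ne.symm hkj) hS hScard hk0 (h false (proj J τ)) (a false),
        sum_range_moment _ htj, sum_range_moment _ hfj] at h1
      have hu : ((-1 : ZMod p) ^ p) ≠ 0 := pow_ne_zero _ (neg_ne_zero.2 one_ne_zero)
      exact (mul_left_cancel₀ hu h1).symm
    -- merge the two representations
    have hproj2 : ∀ u, proj J (proj (insert j0 J) u) = proj J u := proj_proj_insert J j0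
    have hprojj0 : ∀ u, proj (insert j0 J) u j0 = u j0 := proj_insert_self J j0
    by_cases hcaseF : ∃ τ j, a false j ≠ 0 ∧ resCount (h false (proj J τ)) ≠ 0
    · obtain ⟨τ, j, hj, hN⟩ := hcaseF
      obtain ⟨c, -, hca⟩ := direction_extract (a := a false) (b := a true) hN hj (hE1 τ)
        (fun k hkj htj => hE2 τ j k hkj hj htj)
      have hfun : a true = fun k => c * a false k := funext hca
      refine ⟨a false, fun v z => if v j0 then h true (proj J v) (c * z) else h false (proj J v) z, fun u => ?_⟩
      dsimp only
      rw [hf_eq u, hprojj0, hproj2]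
      cases u j0
      · simp
      · rw [hfun, blin_smul]; simp
    · by_cases hcaseT : ∃ τ j, a true j ≠ 0 ∧ resCount (h true (proj J τ)) ≠ 0
      · obtain ⟨τ, j, hj, hN⟩ := hcaseT
        obtain ⟨c, -, hca⟩ := direction_extract (a := a true) (b := a false) hN hj (fun k => (hE1 τ k).symm)
          (fun k hkj hfj => (hE2 τ j k hkj hfj hj).symm)
        have hfun : a false = fun k => c * a true k := funext hca
        refine ⟨a true, fun v z => if v j0 then h true (proj J v) z else h false (proj J v) (c * z), fun u => ?_⟩
        dsimp only
        rw [hf_eq u, hprojj0, hproj2]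
        cases u j0
        · rw [hfun, blin_smul]; simp
        · simp
      · -- degenerate: both restrictions ignore the blocks
        push Not at hcaseF hcaseT
        have hdeg : ∀ σ u, h σ (proj J u) (blin A (a σ) u) = h σ (proj J u) 0 := by
          intro σ u
          by_cases ha : ∀ j, a σ j = 0
          · rw [blin_zero_coeff ha]
          · push Not at ha
            obtain ⟨j, hj⟩ := ha
            have h0 : resCount (h σ (proj J u)) = 0 := by
              cases σ
              · exact hcaseF u j hj
              · exact hcaseT u j hj
            exact const_of_resCount_eq_zero h0 _
        refine ⟨a false, fun v _ => h (v j0) (proj J v) 0, fun u => ?_⟩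
        dsimp only
        rw [hf_eq u, hdeg, hprojj0, hproj2]

/-- The same in the node's `FrobStructureLaw` shape: ONE coefficient vector (constant on blocks, zero elsewhere)
and a junta pattern. -/
theorem jBlock_frob_law (p : ℕ) [hp : Fact p.Prime] (A : Fin m → Finset (Fin n))
    (hdis : ∀ j k, j ≠ k → Disjoint (A j) (A k)) (hA : ∀ j, p - 1 ≤ (A j).card)
    (J : Finset (Fin n)) (hJ : ∀ j, Disjoint J (A j)) (f : (Fin n → Bool) → Bool)
    (hsym : ∀ u v : Fin n → Bool, (∀ i ∈ J, u i = v i) → (∀ j, bw (A j) u = bw (A j) v) → f u = f v)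
    (hf : HasDegF p f (p - 1)) :
    ∃ (c : Fin n → ZMod p) (h : (Fin n → Bool) → ZMod p → Bool), ∀ u,
      f u = h (proj J u) (∑ i, if u i then c i else 0) := by
  obtain ⟨a, h, hh⟩ := jBlock_frob p A hdis hA J hJ f hsym hf
  exact ⟨fun i => ∑ j, if i ∈ A j then a j else 0, h, fun u => by rw [hh u, blin_eq_form]⟩

end SubChar

end Summit.QuantumAdvantage.AdviceFreeQNC0
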